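import Summits.QuantumFields.YangMills.Theorems.AllWindowsColdBoxBoxHighLineSmearedFPOrbitChart
import Summits.QuantumFields.YangMills.Theorems.AllWindowsColdBoxBoxHighLineOrbitJacobianDefs
import Mathlib
import HarnessLib

/-!
# TASK T-S5/U5.4J, brick J1 (part 2/2): `OrbitMapJacobianDet` BY NAME — the orbit map is differentiable everywhere and
# `|det DΨ_V(v)| = |det F(V^{pauliGauge A})| · Π_x 2π²σ(‖A_x‖)` (planner ym-idea-2 g18, `Cruxes/BoxWindowHighSU2213/TaskS5Laplace.lean`;
# LINE-19 ⟨stmt-QuantumFields-24004⟩/⟨24335⟩, LINE-20 ⟨24336⟩)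

Free-hands work of width seat `ym-line-sfw-p2-w3` (g39, cell `ym-idea-1`), over part 1 (`…SmearedFPOrbitChart`: the shift to the base point,
`hasFDerivAt_thetaHat_one`, `hasFDerivAt_chartK`) and ✓Literature `B13HaarSigmaJacobian` (`jac`, `coe_jac_apply`, `det_jac_su2`).
The task texts `orbitMapFlat` and `OrbitMapJacobianDet` are those of ✓`…OrbitJacobianDefs` (builder fcl-p3's verbatim copy of the task file).

* `orbitMapFlat_add` — `Ψ_V(v + w) = Θ̂_{V^{g_A}}(κ_A(w))`, hence `hasFDerivAt_orbitMapFlat : HasFDerivAt (orbitMapFlat H V) (thetaLin ∘ chartKDeriv) v`;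
* `jPauli A := su2Equiv⁻¹ ∘ jac(−X(A)) ∘ su2Equiv` (the chart Jacobian in Pauli coordinates, `X(jPauli A w) = gSer(ad(−X A))(X w)`),
  `jBlock` its direct sum over the interior sites, and **`fderiv_eq` : DΨ_V(v) = fpLinear H (V^{pauliGauge A}) ∘ jBlock A`**;
* determinants: `det (jPauli A) = (sin‖A‖/‖A‖)² = 2π²·sigmaSU2 ‖A‖` (✓`det_jac_su2`, `LinearMap.det_conj`), `det jBlock = Π_x det (jPauli A_x)`
  (block diagonal after `Equiv.prodComm`), `det fpLinear = det fpOperator` (✓`LinearMap.det_toMatrix'`), whence ★`orbitMapJacobianDet`;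
* matrix letters for the consumers (w2 J2 / w4 J4): `pauliJac H v := toMatrix' (jBlock (♭⁻¹v))`, `pauliJac_eq_blockDiagonal`, `pauliJac_apply`,
  `det_pauliJac`, ★`hasFDerivAt_orbitMapFlat_matrix` / `fderiv_orbitMapFlat` : `DΨ_V(v) = toLin' (fpOperator H (V^{pauliGauge A}) * pauliJac H v)`,
  `det_fderiv_orbitMapFlat`; the per-block formula is `su2Coord_jPauli` (`X(jPauli A w) = gSer(ad(−X A))(X w)`, ✓`coe_jac_apply`).

Mathlib + tree only; no `sorry`.  HONEST LABEL: one brick of step (1b)/(J) of the XL stubs S5/U5; T-S5.4J, S5, U5, ⟨24004⟩ ⟨24335⟩ ⟨24336⟩ remain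
OPEN; no crux, rung or summit is proved; the Yang–Mills mass gap is NOT proved by this file.
-/

set_option autoImplicit false

noncomputable section

open Matrix Finset Filter Topology NormedSpace
open scoped Matrix.Norms.Operator
open Literature.MathematicalPhysics.QuantumFieldTheory.Balaban1983to89.B10Eq18SigmaSU2 (su2Coord)
open Literature.MathematicalPhysics.QuantumFieldTheory.Balaban1983to89.B10Eq22Rescaling (sigmaSU2)
open Literature.MathematicalPhysics.QuantumFieldTheory.Balaban1983to89.B13HaarSigmaJacobian
  (jac hlie_su2 su2Equiv su2Equiv_apply_coe coe_jac_apply det_jac_su2 det_jac_su2_zero)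
open Literature.Analysis.Calculus.ExpDifferential (gSer ad)
open Literature.MathematicalPhysics.QuantumLattice (LGConfig ZdEdge gaugeTransformZd)
open Literature.Probability.LatticeModels (Site)
open Summit.QuantumFields.YangMills.Theorems.CoarseStiffnessTailCommutatorChart (star_su2Coord)


namespace Summit.QuantumFields.YangMills.Theorems.AllWindowsColdBoxBoxHighLine

-- `orbitMapFlat`, `OrbitMapJacobianDet`: the task texts, ✓`…OrbitJacobianDefs` (builder fcl-p3).

namespace OrbitChart

/-! ## The shift and the derivative -/

/-- **THE SHIFT**: `Ψ_V(v + w) = Θ̂_{V^{pauliGauge A}}(κ_A(w))`, `A = ♭⁻¹ v`. -/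
theorem orbitMapFlat_add (H : ℕ) (V : LGConfig 4 SU2) (v w : ↥(interiorSites H) × Fin 3 → ℝ) :
    orbitMapFlat H V (v + w)
      = thetaHat H (gaugeTransformZd (pauliGauge H (vecToField H v)) V) (chartK H (vecToField H v) w) := by
  funext p
  simp only [orbitMapFlat, thetaHat, divDefect_apply, vecToField_add, imVec_eq_imVecM, coe_gaugeTransformZd_pauliGauge_add, sub_add_cancel]

/-- ★ **The orbit map is differentiable at every point, with derivative `thetaLin ∘ chartKDeriv`.** -/
theorem hasFDerivAt_orbitMapFlat (H : ℕ) (V : LGConfig 4 SU2) (v : ↥(interiorSites H) × Fin 3 → ℝ) :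
    HasFDerivAt (orbitMapFlat H V)
      ((thetaLin H (gaugeTransformZd (pauliGauge H (vecToField H v)) V)).comp (chartKDeriv H (vecToField H v))) v := by
  have hθ : HasFDerivAt (thetaHat H (gaugeTransformZd (pauliGauge H (vecToField H v)) V))
      (thetaLin H (gaugeTransformZd (pauliGauge H (vecToField H v)) V)) (chartK H (vecToField H v) 0) := by
    rw [chartK_zero]; exact hasFDerivAt_thetaHat_one H _
  have hcomp := hθ.comp 0 (hasFDerivAt_chartK H (vecToField H v))
  -- shift: `orbitMapFlat H V u = Θ̂ (κ (u − v))`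
  have hsub : HasFDerivAt (fun u : ↥(interiorSites H) × Fin 3 → ℝ => u - v) (ContinuousLinearMap.id ℝ _) v :=
    (hasFDerivAt_id v).sub_const v
  have hcomp' : HasFDerivAt (thetaHat H (gaugeTransformZd (pauliGauge H (vecToField H v)) V) ∘ chartK H (vecToField H v))
      ((thetaLin H (gaugeTransformZd (pauliGauge H (vecToField H v)) V)).comp (chartKDeriv H (vecToField H v))) (v - v) := by
    rw [sub_self]; exact hcomp
  have h := hcomp'.comp v (f := fun u => u - v) hsub
  rw [ContinuousLinearMap.comp_id] at h
  refine h.congr_of_eventuallyEq (Eventually.of_forall fun u => ?_)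
  show orbitMapFlat H V u = thetaHat H _ (chartK H (vecToField H v) (u - v))
  rw [← orbitMapFlat_add, add_sub_cancel]

/-! ## The chart Jacobian in Pauli coordinates -/

/-- The Jacobian of the right-trivialised exponential chart at `A`, in Pauli coordinates: `su2Equiv⁻¹ ∘ jac(−X A) ∘ su2Equiv`.
[problem-side definition] -/
def jPauli (A : Fin 3 → ℝ) : (Fin 3 → ℝ) →ₗ[ℝ] (Fin 3 → ℝ) :=
  (su2Equiv.symm.toLinearMap ∘ₗ (jac hlie_su2 (-su2Equiv A)).toLinearMap) ∘ₗ su2Equiv.toLinearMap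

/-- `X(jPauli A w) = gSer(ad(−X A))(X w)`. -/
theorem su2Coord_jPauli (A w : Fin 3 → ℝ) : su2Coord (jPauli A w) = gSer ℝ (ad ℝ (-su2Coord A)) (su2Coord w) := by
  unfold jPauli
  simp only [LinearMap.coe_comp, Function.comp_apply, LinearEquiv.coe_toLinearMap, ContinuousLinearMap.coe_coe]
  have h := coe_jac_apply hlie_su2 (-su2Equiv A) (su2Equiv w)
  rw [Submodule.coe_neg, su2Equiv_apply_coe, su2Equiv_apply_coe] at h
  rw [← h, ← su2Equiv_apply_coe, LinearEquiv.apply_symm_apply]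

/-- `det (jPauli A) = det jac(−X A)`. -/
theorem det_jPauli_eq (A : Fin 3 → ℝ) :
    LinearMap.det (jPauli A) = LinearMap.det ((jac hlie_su2 (-su2Equiv A)).toLinearMap) := by
  have h := LinearMap.det_conj ((jac hlie_su2 (-su2Equiv A)).toLinearMap) su2Equiv.symm
  rw [LinearEquiv.symm_symm] at h
  exact h

/-- **`det (jPauli A) = (if A = 0 then 1 else sin‖A‖/‖A‖)²`** in the letters of `sigmaSU2`: `= 2π²·sigmaSU2 (√(A⬝A))`. -/
theorem det_jPauli (A : Fin 3 → ℝ) :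
    LinearMap.det (jPauli A) = 2 * Real.pi ^ 2 * sigmaSU2 (Real.sqrt (A ⬝ᵥ A)) := by
  rw [det_jPauli_eq, sigmaSU2]
  have hπ : (2 * Real.pi ^ 2) * (1 / (2 * Real.pi ^ 2)) = 1 := by field_simp
  by_cases hA : A = 0
  · subst hA
    rw [map_zero, neg_zero]
    have h0 := det_jac_su2_zero
    rw [map_zero] at h0
    have hs : Real.sqrt ((0 : Fin 3 → ℝ) ⬝ᵥ 0) = 0 := by simp
    rw [h0, hs, if_pos rfl, one_pow, mul_one]
    exact hπ.symm
  · have hne : -A ≠ 0 := neg_ne_zero.2 hA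
    have h := det_jac_su2 (A := -A) hne
    rw [map_neg, neg_dotProduct, dotProduct_neg, neg_neg, Complex.coe_algebraMap] at h
    have h' : LinearMap.det ((jac hlie_su2 (-su2Equiv A)).toLinearMap) = (Real.sin (Real.sqrt (A ⬝ᵥ A)) / Real.sqrt (A ⬝ᵥ A)) ^ 2 := by
      exact_mod_cast h
    rw [h']
    have hpos : Real.sqrt (A ⬝ᵥ A) ≠ 0 := by
      intro h0
      rw [Real.sqrt_eq_zero'] at h0
      have hnn : 0 ≤ A ⬝ᵥ A := by
        rw [dotProduct]; exact Finset.sum_nonneg fun i _ => mul_self_nonneg _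
      have hz : A ⬝ᵥ A = 0 := le_antisymm h0 hnn
      exact hA (dotProduct_self_eq_zero.1 hz)
    rw [if_neg hpos, ← mul_assoc, hπ, one_mul]

/-- The Euclidean length of a Pauli coordinate vector is `√(A⬝A)`. -/
theorem norm_eq_sqrt_dotProduct (a : EuclideanSpace ℝ (Fin 3)) : ‖a‖ = Real.sqrt (WithLp.ofLp a ⬝ᵥ WithLp.ofLp a) := by
  rw [EuclideanSpace.norm_eq, dotProduct]
  congr 1
  refine Finset.sum_congr rfl fun c _ => ?_
  rw [Real.norm_eq_abs, sq_abs, sq]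

/-! ## The block-diagonal Jacobian and the identification of the derivative -/

/-- The direct sum of the chart Jacobians over the interior sites, on flat coordinate vectors. [problem-side definition] -/
def jBlock (H : ℕ) (A : ↥(interiorSites H) → EuclideanSpace ℝ (Fin 3)) :
    (↥(interiorSites H) × Fin 3 → ℝ) →ₗ[ℝ] (↥(interiorSites H) × Fin 3 → ℝ) where
  toFun w p := jPauli (WithLp.ofLp (A p.1)) (fun c => w (p.1, c)) p.2
  map_add' w w' := by
    funext p
    have : (fun c => (w + w') (p.1, c)) = (fun c => w (p.1, c)) + fun c => w' (p.1, c) := rfl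
    rw [this, map_add]; rfl
  map_smul' r w := by
    funext p
    have : (fun c => (r • w) (p.1, c)) = r • fun c => w (p.1, c) := rfl
    rw [this, map_smul]; rfl

/-- Evaluation of `jBlock`. -/
theorem jBlock_apply (H : ℕ) (A : ↥(interiorSites H) → EuclideanSpace ℝ (Fin 3)) (w : ↥(interiorSites H) × Fin 3 → ℝ)
    (p : ↥(interiorSites H) × Fin 3) : jBlock H A w p = jPauli (WithLp.ofLp (A p.1)) (fun c => w (p.1, c)) p.2 := rfl

/-- The extension by zero of the chart derivative is `X` of the zero-extended Pauli field `♭⁻¹(jBlock w)`. -/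
theorem ext0_chartKDeriv (H : ℕ) (A : ↥(interiorSites H) → EuclideanSpace ℝ (Fin 3)) (w : ↥(interiorSites H) × Fin 3 → ℝ) (z : Site 4) :
    ext0 H (chartKDeriv H A w) z = su2Coord (WithLp.ofLp (extPauli H (vecToField H (jBlock H A w)) z)) := by
  by_cases hz : z ∈ interiorSites H
  · rw [ext0_of_mem _ hz, chartKDeriv_apply, extPauli_of_mem _ hz, ← su2Coord_jPauli]
    rfl
  · rw [ext0_of_not_mem _ hz, extPauli_of_not_mem _ hz]
    have : (su2Coord fun _ : Fin 3 => (0 : ℝ)) = 0 := by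
      ext i j; fin_cases i <;> fin_cases j <;> simp [su2Coord]
    exact (this.symm).trans rfl

/-- ★ **THE DERIVATIVE IS `fpLinear ∘ jBlock`**: `thetaLin_W ∘ chartKDeriv_A = fpLinear H W ∘ jBlock A` (at `W = V^{pauliGauge A}`, or any `W`). -/
theorem thetaLin_comp_chartKDeriv (H : ℕ) (W : LGConfig 4 SU2) (A : ↥(interiorSites H) → EuclideanSpace ℝ (Fin 3)) :
    ((thetaLin H W).comp (chartKDeriv H A) : (↥(interiorSites H) × Fin 3 → ℝ) →ₗ[ℝ] (↥(interiorSites H) × Fin 3 → ℝ))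
      = fpLinear H W ∘ₗ jBlock H A := by
  refine LinearMap.ext fun w => ?_
  funext p
  obtain ⟨x, c⟩ := p
  show ((thetaLin H W).comp (chartKDeriv H A)) w (x, c) = fpLinear H W (jBlock H A w) (x, c)
  rw [ContinuousLinearMap.comp_apply, thetaLin_apply, fpLinear_apply, divDefectLin_apply]
  simp only [thetaLinFun, pauliLinkLin, ext0_chartKDeriv, star_su2Coord, mul_neg, ← sub_eq_add_neg, sub_add_cancel]

/-! ## The determinant of `jBlock` -/

/-- The matrix of `jBlock` is the block-diagonal matrix of the `jPauli`s after swapping the index factors. -/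
theorem toMatrix_jBlock (H : ℕ) (A : ↥(interiorSites H) → EuclideanSpace ℝ (Fin 3)) :
    LinearMap.toMatrix' (jBlock H A)
      = (Matrix.blockDiagonal fun y : ↥(interiorSites H) => LinearMap.toMatrix' (jPauli (WithLp.ofLp (A y)))).reindex
          (Equiv.prodComm _ _) (Equiv.prodComm _ _) := by
  ext ⟨y, c⟩ ⟨y', c'⟩
  simp only [Matrix.reindex_apply, Matrix.submatrix_apply, Equiv.prodComm_symm, Equiv.prodComm_apply, Prod.swap_prod_mk,
    Matrix.blockDiagonal_apply, LinearMap.toMatrix'_apply, jBlock_apply]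
  by_cases hy : y = y'
  · subst hy
    rw [if_pos rfl]
    have h1 : (fun c'' => (Pi.single (y, c') (1 : ℝ) : ↥(interiorSites H) × Fin 3 → ℝ) (y, c'')) = Pi.single c' 1 := by
      funext c''
      simp [Pi.single_apply]
    rw [h1]
  · rw [if_neg hy]
    have hzero : (fun c'' => (Pi.single (y', c') (1 : ℝ) : ↥(interiorSites H) × Fin 3 → ℝ) (y, c'')) = 0 := by
      funext c''
      have : ((y, c'') : ↥(interiorSites H) × Fin 3) ≠ (y', c') := fun h => hy (congrArg Prod.fst h)
      simp [this]
    rw [hzero, map_zero, Pi.zero_apply]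

/-- **`det jBlock = Π_y det (jPauli A_y)`.** -/
theorem det_jBlock (H : ℕ) (A : ↥(interiorSites H) → EuclideanSpace ℝ (Fin 3)) :
    LinearMap.det (jBlock H A) = ∏ y : ↥(interiorSites H), LinearMap.det (jPauli (WithLp.ofLp (A y))) := by
  rw [← LinearMap.det_toMatrix', toMatrix_jBlock, Matrix.det_reindex_self, Matrix.det_blockDiagonal]
  refine Finset.prod_congr rfl fun y _ => ?_
  rw [LinearMap.det_toMatrix']

/-! ## Matrix letters for the consumers (w2's J2, w4's J4): `DΨ_V(v) = toLin' (fpOperator · pauliJac)` -/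

/-- **The chart Jacobian matrix** `pauliJac H v`: the matrix of `jBlock (♭⁻¹ v)` in the coordinate basis of `ℝ^{I×3}` — block-diagonal over the
interior sites with blocks `jac(−X A_x)` in Pauli coordinates (`A = ♭⁻¹ v`). [problem-side definition] -/
def pauliJac (H : ℕ) (v : ↥(interiorSites H) × Fin 3 → ℝ) : Matrix (↥(interiorSites H) × Fin 3) (↥(interiorSites H) × Fin 3) ℝ :=
  LinearMap.toMatrix' (jBlock H (vecToField H v))

/-- `pauliJac` is the reindexed block-diagonal matrix of the per-site chart Jacobians. -/
theorem pauliJac_eq_blockDiagonal (H : ℕ) (v : ↥(interiorSites H) × Fin 3 → ℝ) :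
    pauliJac H v = (Matrix.blockDiagonal fun y : ↥(interiorSites H) => LinearMap.toMatrix' (jPauli fun c => v (y, c))).reindex
      (Equiv.prodComm _ _) (Equiv.prodComm _ _) := by
  rw [pauliJac, toMatrix_jBlock]
  rfl

/-- Entries of `pauliJac`: zero off the diagonal blocks, the matrix of `jPauli A_y` on them. -/
theorem pauliJac_apply (H : ℕ) (v : ↥(interiorSites H) × Fin 3 → ℝ) (y y' : ↥(interiorSites H)) (c c' : Fin 3) :
    pauliJac H v (y, c) (y', c') = if y = y' then LinearMap.toMatrix' (jPauli fun c'' => v (y, c'')) c c' else 0 := by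
  rw [pauliJac_eq_blockDiagonal, Matrix.reindex_apply, Matrix.submatrix_apply]
  simp only [Equiv.prodComm_symm, Equiv.prodComm_apply, Prod.swap_prod_mk, Matrix.blockDiagonal_apply]

/-- **`det pauliJac = Π_x 2π²·σ(‖A_x‖)`.** -/
theorem det_pauliJac (H : ℕ) (v : ↥(interiorSites H) × Fin 3 → ℝ) :
    (pauliJac H v).det = ∏ y : ↥(interiorSites H), 2 * Real.pi ^ 2 * sigmaSU2 ‖vecToField H v y‖ := by
  rw [pauliJac, LinearMap.det_toMatrix', det_jBlock]
  refine Finset.prod_congr rfl fun y _ => ?_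
  rw [det_jPauli, ← norm_eq_sqrt_dotProduct]

/-- `det pauliJac ≥ 0`. -/
theorem det_pauliJac_nonneg (H : ℕ) (v : ↥(interiorSites H) × Fin 3 → ℝ) : 0 ≤ (pauliJac H v).det := by
  rw [det_pauliJac]
  refine Finset.prod_nonneg fun y _ => ?_
  have hσ : 0 ≤ sigmaSU2 ‖vecToField H v y‖ := by
    rw [sigmaSU2]; exact mul_nonneg (by positivity) (sq_nonneg _)
  have h2 : (0 : ℝ) ≤ 2 * Real.pi ^ 2 := by positivity
  exact mul_nonneg h2 hσ

/-- ★ **THE DERIVATIVE IN MATRIX LETTERS** (the export asked for by w2, 18:29:28Z): `DΨ_V(v) = toLin' (fpOperator H (V^{pauliGauge A}) * pauliJac H v)`. -/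
theorem hasFDerivAt_orbitMapFlat_matrix (H : ℕ) (V : LGConfig 4 SU2) (v : ↥(interiorSites H) × Fin 3 → ℝ) :
    HasFDerivAt (orbitMapFlat H V)
      (LinearMap.toContinuousLinearMap
        (Matrix.toLin' (fpOperator H (gaugeTransformZd (pauliGauge H (vecToField H v)) V) * pauliJac H v))) v := by
  have h := hasFDerivAt_orbitMapFlat H V v
  have heq : (thetaLin H (gaugeTransformZd (pauliGauge H (vecToField H v)) V)).comp (chartKDeriv H (vecToField H v))
      = LinearMap.toContinuousLinearMap
          (Matrix.toLin' (fpOperator H (gaugeTransformZd (pauliGauge H (vecToField H v)) V) * pauliJac H v)) := by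
    refine ContinuousLinearMap.coe_inj.1 ?_
    rw [thetaLin_comp_chartKDeriv, LinearMap.coe_toContinuousLinearMap, fpOperator, pauliJac, ← LinearMap.toMatrix'_comp,
      Matrix.toLin'_toMatrix']
  rwa [heq] at h

/-- ★ `fderiv` form of the export: `fderiv ℝ (orbitMapFlat H V) v = toLin' (fpOperator H (V^{pauliGauge A}) * pauliJac H v)`. -/
theorem fderiv_orbitMapFlat (H : ℕ) (V : LGConfig 4 SU2) (v : ↥(interiorSites H) × Fin 3 → ℝ) :
    fderiv ℝ (orbitMapFlat H V) v
      = LinearMap.toContinuousLinearMap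
          (Matrix.toLin' (fpOperator H (gaugeTransformZd (pauliGauge H (vecToField H v)) V) * pauliJac H v)) :=
  (hasFDerivAt_orbitMapFlat_matrix H V v).fderiv

/-- ★ Determinant of the derivative, signed: `det DΨ_V(v) = det F(V^{pauliGauge A}) · det pauliJac`. -/
theorem det_fderiv_orbitMapFlat (H : ℕ) (V : LGConfig 4 SU2) (v : ↥(interiorSites H) × Fin 3 → ℝ) :
    (fderiv ℝ (orbitMapFlat H V) v).det
      = (fpOperator H (gaugeTransformZd (pauliGauge H (vecToField H v)) V)).det * (pauliJac H v).det := by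
  rw [fderiv_orbitMapFlat, ContinuousLinearMap.det, LinearMap.coe_toContinuousLinearMap, LinearMap.det_toLin', Matrix.det_mul]

/-! ## J1 BY NAME -/

/-- ★★★ **J1 `OrbitMapJacobianDet`, BY NAME.** -/
theorem orbitMapJacobianDet : OrbitMapJacobianDet := by
  intro H V v
  refine ⟨(hasFDerivAt_orbitMapFlat H V v).differentiableAt, ?_⟩
  rw [det_fderiv_orbitMapFlat, abs_mul, abs_of_nonneg (det_pauliJac_nonneg H v), det_pauliJac]

end OrbitChart

end Summit.QuantumFields.YangMills.Theorems.AllWindowsColdBoxBoxHighLine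

end
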